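/-
Copyright (c) 2026 the pub-hodgecm-mathlib formalisation cell (harness21).  Prover seat hodgecm-mathlib-K2E2-p12 (g5): Track B «K2-LIT», ENGINE E1,
h413 = stmt-HodgeConjecture-24833; (q10) «R7₃-SCALAR» FILE 3, brick (3-iv-d) «FINITE INTEGRABILITY FROM hT» (discharging the letter `hfin` of ★ (3-iv-c)).
-/
import Summits.HodgeConjecture.HodgeConjecture.Theorems.K2E1IntertwiningScalarEulerProductU3    -- ★ (3-iv-c): §1 pointwise `H^σ = ARCH^{−σ}·h_f^{−σ}`; brings (a2)₃, (ν-1), `K2E1AdelicFourierEnvelope`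
import Summits.HodgeConjecture.HodgeConjecture.Theorems.K2E1CentreLineMassU3                -- ★ p858088 (K2E4-p11): `integrable_centreLine_borelHeight_rpow_three` (centre-line fibres are `L¹`)
import HarnessLib

/-!
# K2·E1 — `K2E1IntertwiningFiniteIntegrabilityU3` ((q10) «R7₃-SCALAR» FILE 3, brick (3-iv-d)): THE FINITE PART OF `H(ι(w₀)·)^σ` IS INTEGRABLE — the letter `hfin` of
# ★ (3-iv-c) `K2E1IntertwiningScalarEulerProductU3` DISCHARGED from `hT` (`H(ι(w₀)·)^σ ∈ L¹(N(𝔸))`) and the centre-line integrability ★ `K2E1CentreLineMassU3`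

Track B ∕ K2-LIT, crux h413 = `stmt-HodgeConjecture-24833`, route of record `HCCMUnconditional`; cell `hodgecm-mathlib`, squad K2, ENGINE E1 (campaign «EIS-RANK-ONE», R7 at
`N = 3`).  THEOREMS ONLY (no `def`, no instance, no notation, no `sorry`; default heartbeats); lane `--supports stmt-HodgeConjecture-24833 --as helper` (count-neutral).
FUBINI–TONELLI BOOKKEEPING.  `Φ(X, s) := H(ι(w₀)·u(X, θ s))^σ = a(X_∞, s_∞)·g(X_f, s_f)` (★ (3-iv-c) §1; `a = ARCH^{−σ} > 0`, `g = h_f^{−σ} > 0`).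
* §1 `continuous_coe_heightFactor` — `(X, b) ↦ h_f(X, b)` is continuous (`h_f = (H(ι(w₀)u(X,θ(0,b)))·ARCH(X_∞,0))⁻¹` by ★ (a2)₃; ★ `continuous_borelHeight`), hence
  `aestronglyMeasurable_heightFactor_rpow`.
* §2 `integrable_centreLine` (★ `integrable_centreLine_borelHeight_rpow_three` at `g = 1`, every `X`), `integrable_prod_centreLine` (★ `integrable_iff_integrable_prod` on `𝔸_{L⁺}`),
  **`integrable_heightFactor_rpow_slice`** ∕ `integrable_arch_rpow_slice` (`prod_right_ae` ∕ `prod_left_ae` + non-vanishing of the other factor), `integral_norm_arch_rpow_pos`.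
* §3 `integral_norm_centreLine_eq` — `∫ ‖Φ(X,·)‖ dμ_F = c_F · (∫ ‖a(X_∞,·)‖ dμ_{F,∞}) · (∫ ‖g(X_f,·)‖ dμ_{F,f})` for EVERY `X` (★ `exists_integral_adele_eq_smul_integral_prod`, `integral_prod_mul`).
* §4 **`integrable_prod_heightFactor_rpow_of_integrable`** (HEAD): `hT ⟹ hfin`, i.e. `(X_f, b) ↦ ((h_f((0, X_f), b)^{−σ} : ℝ) : ℂ) ∈ L¹(μ_{E,f} ⊗ μ_{F,f})` — `hT` ⟹ `Φ ∈ L¹(μ_E ⊗ μ_F)`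
  (★ (ν-1) :93) ⟹ `X ↦ ∫‖Φ(X,·)‖ ∈ L¹(μ_E)` ⟹ (§3, ★ `integrable_iff_integrable_prod` on `𝔸_L`, `prod_right_ae`, §2 positivity) `X_f ↦ ∫‖g(X_f,·)‖ ∈ L¹(μ_{E,f})` ⟹ (`integrable_prod_iff`, §1, §2).
  **`exists_pos_inv_measure_smul_integral_rpow_borelHeight_eq_eulerProduct_three'`**: ★ (3-iv-c)'s head WITHOUT the letter `hfin` (letters `hc1`, `hIw` instead).
HONEST LABEL: HC_CM is proved only modulo the 7 printed citations (2 remaining named inputs: hLiu418 = `stmt-HodgeConjecture-24832`, h413 = `stmt-HodgeConjecture-24833`) until rung 0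
closes; this file asserts no named fact and closes no socket; count-neutral; conditional only on its displayed letters (`hc`, `hc1`, `hIw`, `h𝓕`, `hgood`, `hT`).

## References
* [MoeglinWaldspurger1995] C. Mœglin, J.-L. Waldspurger, *Spectral Decomposition and Eisenstein Series* (1995): II.1.6–II.1.7.
* [CasselsFrohlichANT1967] J. W. S. Cassels, A. Fröhlich (eds.), *Algebraic Number Theory* (1967): Ch. XV §3.3, Thm. 4.1.3.
* [Rogawski1990] J. D. Rogawski, *Automorphic Representations of Unitary Groups in Three Variables* (1990): §7.3.
* [Langlands1971] R. P. Langlands, *Euler Products* (1971): §3.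
-/

set_option autoImplicit false
set_option linter.dupNamespace false -- the mandated namespace repeats `HodgeConjecture.HodgeConjecture`

noncomputable section

open MeasureTheory MeasureTheory.Measure NumberField NumberField.InfinitePlace IsDedekindDomain Filter
open scoped NNReal ENNReal Classical
open Literature.NumberTheory.Automorphic Literature.NumberTheory.Automorphic.UnitaryGroup Literature.NumberTheory.GaloisRepresentations
open Literature.NumberTheory.GaloisRepresentations.IsNonarchimedeanLocalField
open Summit.HodgeConjecture.HodgeConjecture.Cruxes.H413
open Summit.HodgeConjecture.HodgeConjecture.Cruxes.H413.K2E1HeightBigCellLineFormulaU3 (coe_borelHeight_weylLongU_heisChart_line_mul_eq_cm_three one_le_coe_finprod_heisZ_line_cm_three)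
open Summit.HodgeConjecture.HodgeConjecture.Cruxes.H413.K2E1UnipotentHaarNormalisationU3 (integrable_comp_heisChart_traceZeroLine_prod_iff_three)
open Summit.HodgeConjecture.HodgeConjecture.Cruxes.H413.K2E1AdelicFourierEnvelope (exists_integral_adele_eq_smul_integral_prod)
open Summit.HodgeConjecture.HodgeConjecture.Cruxes.H413.K2E1IntertwiningScalarEulerProductU3 (rpow_borelHeight_weylLongU_heisChart_eq
  exists_pos_inv_measure_smul_integral_rpow_borelHeight_eq_eulerProduct_three)
open Summit.HodgeConjecture.HodgeConjecture.Cruxes.H413.K2E1CentreLineMassU3 (integrable_centreLine_borelHeight_rpow_three continuous_coe_heisChart_traceZeroLine)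

namespace Summit.HodgeConjecture.HodgeConjecture.Cruxes.H413.K2E1IntertwiningFiniteIntegrabilityU3

variable (L : Type) [Field L] [NumberField L] [IsCMField L] (hc : IsCMField.complexConj L * IsCMField.complexConj L = 1)
  {δ : L} (hcδ : IsCMField.complexConj L δ = -δ) (hδ : δ ≠ 0)

/-! ## §1 Continuity and measurability of the finite height factor -/

include hc in
/-- **`(X, b) ↦ h_f(X, b)` IS CONTINUOUS on `𝔸_L × 𝔸_{L⁺,f}`**: by ★ (a2)₃ at `s_∞ = 0`, `h_f(X, b) = (H(ι(w₀)·u(X, θ(0, b)))·ARCH(X_∞, 0))⁻¹` with `H` continuous (★ `continuous_borelHeight`),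
the chart continuous and `ARCH` a polynomial in the archimedean norms. [cite: Rogawski1990, §7.3] -/
theorem continuous_coe_heightFactor :
    Continuous fun q : AdeleRing (𝓞 L) L × FiniteAdeleRing (𝓞 ↥(maximalRealSubfield L)) ↥(maximalRealSubfield L) =>
      (((∏ᶠ w : HeightOneSpectrum (𝓞 L), max 1 (max ‖((q.1) : AdeleRing (𝓞 L) L).2 w‖₊
              ‖(heisZ (c := IsCMField.complexConj L) ((q.1) : AdeleRing (𝓞 L) L)
                ((traceZeroLine ↥(maximalRealSubfield L) L (IsCMField.complexConj L) hcδ hδ ((0, q.2) : AdeleRing (𝓞 ↥(maximalRealSubfield L)) ↥(maximalRealSubfield L)) : traceZeroAdele ↥(maximalRealSubfield L) L (IsCMField.complexConj L)) : AdeleRing (𝓞 L) L)).2 w‖₊) : ℝ≥0)) : ℝ) := by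
  -- the continuous expression
  have hH : Continuous fun q : AdeleRing (𝓞 L) L × FiniteAdeleRing (𝓞 ↥(maximalRealSubfield L)) ↥(maximalRealSubfield L) =>
      ((borelHeight (((quasiSplit (↥(maximalRealSubfield L)) L (IsCMField.complexConj L) 3).toAdelic (weylLongU ((IsCMField.complexConj L : L ≃ₐ[↥(maximalRealSubfield L)] L) : L →+* L) (rfl : ((StdForm.antidiagonal 3).over L) = ((StdForm.antidiagonal 3).over L)))) *
        (((heisChart hc (q.1, traceZeroLine ↥(maximalRealSubfield L) L (IsCMField.complexConj L) hcδ hδ (((InfiniteAdeleRing.ringEquiv_mixedSpace ↥(maximalRealSubfield L)).symm 0, q.2) : AdeleRing (𝓞 ↥(maximalRealSubfield L)) ↥(maximalRealSubfield L)))) :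
          ↥(adelicUnipotent ↥(maximalRealSubfield L) L (IsCMField.complexConj L) 3)) : (quasiSplit (↥(maximalRealSubfield L)) L (IsCMField.complexConj L) 3).Adelic) * 1)) : ℝ) :=
    (NNReal.continuous_coe.comp continuous_borelHeight).comp
      ((continuous_const.mul (continuous_subtype_val.comp ((heisChart hc).continuous.comp
        (continuous_fst.prodMk ((traceZeroLine ↥(maximalRealSubfield L) L (IsCMField.complexConj L) hcδ hδ).continuous.comp (continuous_const.prodMk continuous_snd)))))).mul
        continuous_const)
  have hA : Continuous fun q : AdeleRing (𝓞 L) L × FiniteAdeleRing (𝓞 ↥(maximalRealSubfield L)) ↥(maximalRealSubfield L) =>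
      (∏ w : InfinitePlace L, ((1 + ‖(q.1.1) w‖ ^ 2 / 2) ^ 2 + (w δ) ^ 2 * (((0 : NumberField.mixedEmbedding.mixedSpace ↥(maximalRealSubfield L))).1 ⟨w.comap (algebraMap ↥(maximalRealSubfield L) L), K2E1HeightBigCellLineFormulaU2.isReal_comap_maximalRealSubfield L w⟩) ^ 2)) := by
    refine continuous_finsetProd _ fun w _ => ?_
    have h1 : Continuous fun q : AdeleRing (𝓞 L) L × FiniteAdeleRing (𝓞 ↥(maximalRealSubfield L)) ↥(maximalRealSubfield L) => ‖q.1.1 w‖ :=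
      continuous_norm.comp ((continuous_apply w).comp (continuous_fst.comp continuous_fst))
    continuity
  have heq : (fun q : AdeleRing (𝓞 L) L × FiniteAdeleRing (𝓞 ↥(maximalRealSubfield L)) ↥(maximalRealSubfield L) => (((∏ᶠ w : HeightOneSpectrum (𝓞 L), max 1 (max ‖((q.1) : AdeleRing (𝓞 L) L).2 w‖₊
              ‖(heisZ (c := IsCMField.complexConj L) ((q.1) : AdeleRing (𝓞 L) L)
                ((traceZeroLine ↥(maximalRealSubfield L) L (IsCMField.complexConj L) hcδ hδ ((0, q.2) : AdeleRing (𝓞 ↥(maximalRealSubfield L)) ↥(maximalRealSubfield L)) : traceZeroAdele ↥(maximalRealSubfield L) L (IsCMField.complexConj L)) : AdeleRing (𝓞 L) L)).2 w‖₊) : ℝ≥0)) : ℝ)) =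
      fun q => (((borelHeight (((quasiSplit (↥(maximalRealSubfield L)) L (IsCMField.complexConj L) 3).toAdelic (weylLongU ((IsCMField.complexConj L : L ≃ₐ[↥(maximalRealSubfield L)] L) : L →+* L) (rfl : ((StdForm.antidiagonal 3).over L) = ((StdForm.antidiagonal 3).over L)))) *
        (((heisChart hc (q.1, traceZeroLine ↥(maximalRealSubfield L) L (IsCMField.complexConj L) hcδ hδ (((InfiniteAdeleRing.ringEquiv_mixedSpace ↥(maximalRealSubfield L)).symm 0, q.2) : AdeleRing (𝓞 ↥(maximalRealSubfield L)) ↥(maximalRealSubfield L)))) :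
          ↥(adelicUnipotent ↥(maximalRealSubfield L) L (IsCMField.complexConj L) 3)) : (quasiSplit (↥(maximalRealSubfield L)) L (IsCMField.complexConj L) 3).Adelic) * 1)) : ℝ) *
        (∏ w : InfinitePlace L, ((1 + ‖(q.1.1) w‖ ^ 2 / 2) ^ 2 + (w δ) ^ 2 * (((0 : NumberField.mixedEmbedding.mixedSpace ↥(maximalRealSubfield L))).1 ⟨w.comap (algebraMap ↥(maximalRealSubfield L) L), K2E1HeightBigCellLineFormulaU2.isReal_comap_maximalRealSubfield L w⟩) ^ 2)))⁻¹ := by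
    funext q
    have h := coe_borelHeight_weylLongU_heisChart_line_mul_eq_cm_three L hc hcδ hδ
      (k := (1 : (quasiSplit (↥(maximalRealSubfield L)) L (IsCMField.complexConj L) 3).Adelic)) (Subgroup.one_mem _) q.1 q.2 (0 : NumberField.mixedEmbedding.mixedSpace ↥(maximalRealSubfield L))
    have hApos : 0 < (∏ w : InfinitePlace L, ((1 + ‖(q.1.1) w‖ ^ 2 / 2) ^ 2 + (w δ) ^ 2 * (((0 : NumberField.mixedEmbedding.mixedSpace ↥(maximalRealSubfield L))).1 ⟨w.comap (algebraMap ↥(maximalRealSubfield L) L), K2E1HeightBigCellLineFormulaU2.isReal_comap_maximalRealSubfield L w⟩) ^ 2)) :=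
      Finset.prod_pos fun w _ => by positivity
    have hBpos : 0 < (((∏ᶠ w : HeightOneSpectrum (𝓞 L), max 1 (max ‖((q.1) : AdeleRing (𝓞 L) L).2 w‖₊
              ‖(heisZ (c := IsCMField.complexConj L) ((q.1) : AdeleRing (𝓞 L) L)
                ((traceZeroLine ↥(maximalRealSubfield L) L (IsCMField.complexConj L) hcδ hδ ((0, q.2) : AdeleRing (𝓞 ↥(maximalRealSubfield L)) ↥(maximalRealSubfield L)) : traceZeroAdele ↥(maximalRealSubfield L) L (IsCMField.complexConj L)) : AdeleRing (𝓞 L) L)).2 w‖₊) : ℝ≥0)) : ℝ) := lt_of_lt_of_le one_pos (one_le_coe_finprod_heisZ_line_cm_three L hcδ hδ q.1 q.2)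
    rw [h]
    field_simp
  rw [heq]
  refine (hH.mul hA).inv₀ fun q => mul_ne_zero ?_ ?_
  · exact (NNReal.coe_pos.2 (borelHeight_pos _)).ne'
  · exact (Finset.prod_pos fun w _ => by positivity).ne'

include hc in
/-- `(X_f, b) ↦ ((h_f((0, X_f), b)^{−σ} : ℝ) : ℂ)` is a.e.-strongly measurable for any measure on `𝔸_{L,f} × 𝔸_{L⁺,f}` (continuous; `h_f ≥ 1`). [folklore] -/
theorem aestronglyMeasurable_heightFactor_rpow (σ : ℝ)
    [MeasurableSpace (FiniteAdeleRing (𝓞 L) L)] [BorelSpace (FiniteAdeleRing (𝓞 L) L)]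
    [MeasurableSpace (FiniteAdeleRing (𝓞 ↥(maximalRealSubfield L)) ↥(maximalRealSubfield L))] [BorelSpace (FiniteAdeleRing (𝓞 ↥(maximalRealSubfield L)) ↥(maximalRealSubfield L))]
    (μ : Measure (FiniteAdeleRing (𝓞 L) L × FiniteAdeleRing (𝓞 ↥(maximalRealSubfield L)) ↥(maximalRealSubfield L))) :
    AEStronglyMeasurable (fun q : FiniteAdeleRing (𝓞 L) L × FiniteAdeleRing (𝓞 ↥(maximalRealSubfield L)) ↥(maximalRealSubfield L) =>
      ((((∏ᶠ w : HeightOneSpectrum (𝓞 L), max 1 (max ‖((((0 : InfiniteAdeleRing L)), q.1) : AdeleRing (𝓞 L) L).2 w‖₊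
              ‖(heisZ (c := IsCMField.complexConj L) ((((0 : InfiniteAdeleRing L)), q.1) : AdeleRing (𝓞 L) L)
                ((traceZeroLine ↥(maximalRealSubfield L) L (IsCMField.complexConj L) hcδ hδ ((0, q.2) : AdeleRing (𝓞 ↥(maximalRealSubfield L)) ↥(maximalRealSubfield L)) : traceZeroAdele ↥(maximalRealSubfield L) L (IsCMField.complexConj L)) : AdeleRing (𝓞 L) L)).2 w‖₊) : ℝ≥0) : ℝ) ^ (-σ) : ℝ) : ℂ)) μ := by
  haveI : SecondCountableTopology (FiniteAdeleRing (𝓞 L) L) := secondCountableTopology_finiteAdeleRing L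
  haveI : SecondCountableTopology (FiniteAdeleRing (𝓞 ↥(maximalRealSubfield L)) ↥(maximalRealSubfield L)) := secondCountableTopology_finiteAdeleRing _
  have hι : Continuous fun q : FiniteAdeleRing (𝓞 L) L × FiniteAdeleRing (𝓞 ↥(maximalRealSubfield L)) ↥(maximalRealSubfield L) =>
      ((((0 : InfiniteAdeleRing L), q.1) : AdeleRing (𝓞 L) L), q.2) :=
    (continuous_const.prodMk continuous_fst).prodMk continuous_snd
  have h := (continuous_coe_heightFactor L hc hcδ hδ).comp hι
  refine (Complex.continuous_ofReal.comp (h.rpow_const fun q => Or.inl ?_)).aestronglyMeasurable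
  exact (lt_of_lt_of_le one_pos (one_le_coe_finprod_heisZ_line_cm_three L hcδ hδ _ _)).ne'

omit [IsCMField L] in
/-- The archimedean factor `ARCH(X_∞, s)^{−σ}` is nonzero (each place quadratic is `≥ 1`). [folklore] -/
theorem arch_rpow_ne_zero (σ : ℝ) (Xi : InfiniteAdeleRing L) (s : NumberField.mixedEmbedding.mixedSpace ↥(maximalRealSubfield L)) :
    ((((∏ w : InfinitePlace L, ((1 + ‖(Xi) w‖ ^ 2 / 2) ^ 2 + (w δ) ^ 2 * ((s).1 ⟨w.comap (algebraMap ↥(maximalRealSubfield L) L), K2E1HeightBigCellLineFormulaU2.isReal_comap_maximalRealSubfield L w⟩) ^ 2))) ^ (-σ) : ℝ) : ℂ) ≠ 0 := by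
  have hA : 0 < (∏ w : InfinitePlace L, ((1 + ‖(Xi) w‖ ^ 2 / 2) ^ 2 + (w δ) ^ 2 * ((s).1 ⟨w.comap (algebraMap ↥(maximalRealSubfield L) L), K2E1HeightBigCellLineFormulaU2.isReal_comap_maximalRealSubfield L w⟩) ^ 2)) := Finset.prod_pos fun w _ => by positivity
  exact_mod_cast (Real.rpow_pos_of_pos hA _).ne'

/-- The finite factor `h_f(X, b)^{−σ}` is nonzero (`h_f ≥ 1`). [folklore] -/
theorem heightFactor_rpow_ne_zero (σ : ℝ) (X : AdeleRing (𝓞 L) L) (b : FiniteAdeleRing (𝓞 ↥(maximalRealSubfield L)) ↥(maximalRealSubfield L)) :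
    ((((∏ᶠ w : HeightOneSpectrum (𝓞 L), max 1 (max ‖((X) : AdeleRing (𝓞 L) L).2 w‖₊
              ‖(heisZ (c := IsCMField.complexConj L) ((X) : AdeleRing (𝓞 L) L)
                ((traceZeroLine ↥(maximalRealSubfield L) L (IsCMField.complexConj L) hcδ hδ ((0, b) : AdeleRing (𝓞 ↥(maximalRealSubfield L)) ↥(maximalRealSubfield L)) : traceZeroAdele ↥(maximalRealSubfield L) L (IsCMField.complexConj L)) : AdeleRing (𝓞 L) L)).2 w‖₊) : ℝ≥0) : ℝ) ^ (-σ) : ℝ) : ℂ) ≠ 0 := by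
  have hB : 0 < (((∏ᶠ w : HeightOneSpectrum (𝓞 L), max 1 (max ‖((X) : AdeleRing (𝓞 L) L).2 w‖₊
              ‖(heisZ (c := IsCMField.complexConj L) ((X) : AdeleRing (𝓞 L) L)
                ((traceZeroLine ↥(maximalRealSubfield L) L (IsCMField.complexConj L) hcδ hδ ((0, b) : AdeleRing (𝓞 ↥(maximalRealSubfield L)) ↥(maximalRealSubfield L)) : traceZeroAdele ↥(maximalRealSubfield L) L (IsCMField.complexConj L)) : AdeleRing (𝓞 L) L)).2 w‖₊) : ℝ≥0)) : ℝ) := lt_of_lt_of_le one_pos (one_le_coe_finprod_heisZ_line_cm_three L hcδ hδ X b)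
  exact_mod_cast (Real.rpow_pos_of_pos hB _).ne'


/-! ## §2 Slices: centre-line integrability at every `X`, and the two factors separately -/

section Slices

variable [MeasurableSpace (AdeleRing (𝓞 ↥(maximalRealSubfield L)) ↥(maximalRealSubfield L))] [BorelSpace (AdeleRing (𝓞 ↥(maximalRealSubfield L)) ↥(maximalRealSubfield L))]
  [MeasurableSpace (InfiniteAdeleRing ↥(maximalRealSubfield L))] [BorelSpace (InfiniteAdeleRing ↥(maximalRealSubfield L))]
  [MeasurableSpace (FiniteAdeleRing (𝓞 ↥(maximalRealSubfield L)) ↥(maximalRealSubfield L))] [BorelSpace (FiniteAdeleRing (𝓞 ↥(maximalRealSubfield L)) ↥(maximalRealSubfield L))]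
  (μF : Measure (AdeleRing (𝓞 ↥(maximalRealSubfield L)) ↥(maximalRealSubfield L))) [μF.IsAddHaarMeasure] (μF₁ : Measure (InfiniteAdeleRing ↥(maximalRealSubfield L))) [μF₁.IsAddHaarMeasure]
  (μF₂ : Measure (FiniteAdeleRing (𝓞 ↥(maximalRealSubfield L)) ↥(maximalRealSubfield L))) [μF₂.IsAddHaarMeasure]

include hc in
omit [MeasurableSpace (InfiniteAdeleRing ↥(maximalRealSubfield L))] [BorelSpace (InfiniteAdeleRing ↥(maximalRealSubfield L))]
  [MeasurableSpace (FiniteAdeleRing (𝓞 ↥(maximalRealSubfield L)) ↥(maximalRealSubfield L))] [BorelSpace (FiniteAdeleRing (𝓞 ↥(maximalRealSubfield L)) ↥(maximalRealSubfield L))] in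
/-- **The centre-line fibre `s ↦ H(ι(w₀)·u(X, θ s))^σ` is `μ_F`-integrable for EVERY `X`** (`σ > 2`; ★ `integrable_centreLine_borelHeight_rpow_three` at `g = 1`, in `ℂ`).
[cite: MoeglinWaldspurger1995, II.1.7] -/
theorem integrable_centreLine (hc1 : IsCMField.complexConj L ≠ 1)
    (hIw : ∀ g : (quasiSplit (↥(maximalRealSubfield L)) L (IsCMField.complexConj L) 3).Adelic, ∃ b ∈ borelAdelic ↥(maximalRealSubfield L) L (IsCMField.complexConj L) 3, ∃ k : (quasiSplit (↥(maximalRealSubfield L)) L (IsCMField.complexConj L) 3).Adelic,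
      adelicVal ↥(maximalRealSubfield L) L (IsCMField.complexConj L) 3 ((StdForm.antidiagonal 3).over L) k ∈ standardMaximalCompactGL 3 L ∧ g = b * k)
    {σ : ℝ} (hσ : 2 < σ) (X : AdeleRing (𝓞 L) L) :
    Integrable (fun s : AdeleRing (𝓞 ↥(maximalRealSubfield L)) ↥(maximalRealSubfield L) => ((((borelHeight (((quasiSplit (↥(maximalRealSubfield L)) L (IsCMField.complexConj L) 3).toAdelic (weylLongU ((IsCMField.complexConj L : L ≃ₐ[↥(maximalRealSubfield L)] L) : L →+* L) (rfl : ((StdForm.antidiagonal 3).over L) = ((StdForm.antidiagonal 3).over L)))) * (((heisChart hc (X, traceZeroLine ↥(maximalRealSubfield L) L (IsCMField.complexConj L) hcδ hδ s)) : ↥(adelicUnipotent ↥(maximalRealSubfield L) L (IsCMField.complexConj L) 3)) : (quasiSplit (↥(maximalRealSubfield L)) L (IsCMField.complexConj L) 3).Adelic))) : ℝ) ^ σ : ℝ) : ℂ)) μF := by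
  have h := Complex.ofRealCLM.integrable_comp (integrable_centreLine_borelHeight_rpow_three hc hc1 hcδ hδ hIw μF hσ X 1)
  simp_rw [mul_one] at h
  exact h

include hc μF in
/-- **Product form of the centre-line integrability**: for every `X`, `(s_∞, b) ↦ ARCH(X_∞, ι s_∞)^{−σ}·h_f(X, b)^{−σ}` is `μ_{F,∞} ⊗ μ_{F,f}`-integrable (§2 + ★ (3-iv-c) §1 pointwise +
★ `integrable_iff_integrable_prod` on `𝔸_{L⁺}`). [cite: CasselsFrohlichANT1967, Ch. XV §3.3] -/
theorem integrable_prod_centreLine (hc1 : IsCMField.complexConj L ≠ 1)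
    (hIw : ∀ g : (quasiSplit (↥(maximalRealSubfield L)) L (IsCMField.complexConj L) 3).Adelic, ∃ b ∈ borelAdelic ↥(maximalRealSubfield L) L (IsCMField.complexConj L) 3, ∃ k : (quasiSplit (↥(maximalRealSubfield L)) L (IsCMField.complexConj L) 3).Adelic,
      adelicVal ↥(maximalRealSubfield L) L (IsCMField.complexConj L) 3 ((StdForm.antidiagonal 3).over L) k ∈ standardMaximalCompactGL 3 L ∧ g = b * k)
    {σ : ℝ} (hσ : 2 < σ) (X : AdeleRing (𝓞 L) L) :
    Integrable (fun p : InfiniteAdeleRing ↥(maximalRealSubfield L) × FiniteAdeleRing (𝓞 ↥(maximalRealSubfield L)) ↥(maximalRealSubfield L) =>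
      ((((∏ w : InfinitePlace L, ((1 + ‖(X.1) w‖ ^ 2 / 2) ^ 2 + (w δ) ^ 2 * (((InfiniteAdeleRing.ringEquiv_mixedSpace ↥(maximalRealSubfield L)) p.1).1 ⟨w.comap (algebraMap ↥(maximalRealSubfield L) L), K2E1HeightBigCellLineFormulaU2.isReal_comap_maximalRealSubfield L w⟩) ^ 2))) ^ (-σ) : ℝ) : ℂ) *
        ((((∏ᶠ w : HeightOneSpectrum (𝓞 L), max 1 (max ‖((X) : AdeleRing (𝓞 L) L).2 w‖₊
              ‖(heisZ (c := IsCMField.complexConj L) ((X) : AdeleRing (𝓞 L) L)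
                ((traceZeroLine ↥(maximalRealSubfield L) L (IsCMField.complexConj L) hcδ hδ ((0, p.2) : AdeleRing (𝓞 ↥(maximalRealSubfield L)) ↥(maximalRealSubfield L)) : traceZeroAdele ↥(maximalRealSubfield L) L (IsCMField.complexConj L)) : AdeleRing (𝓞 L) L)).2 w‖₊) : ℝ≥0) : ℝ) ^ (-σ) : ℝ) : ℂ)) (μF₁.prod μF₂) := by
  have h := (K2E1AdelicFourierEnvelope.integrable_iff_integrable_prod ↥(maximalRealSubfield L) μF μF₁ μF₂ _).1 (integrable_centreLine L hc hcδ hδ μF hc1 hIw hσ X)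
  refine h.congr (Eventually.of_forall fun p => ?_)
  exact rpow_borelHeight_weylLongU_heisChart_eq L hc hcδ hδ σ X ((p.1, p.2) : AdeleRing (𝓞 ↥(maximalRealSubfield L)) ↥(maximalRealSubfield L))

include hc μF μF₁ in
/-- **`b ↦ h_f(X, b)^{−σ}` IS `μ_{F,f}`-INTEGRABLE FOR EVERY `X`** (a.e. `s_∞`-slice of §2's product integrability, the archimedean factor being a nonzero constant on the slice).
[cite: MoeglinWaldspurger1995, II.1.7] -/
theorem integrable_heightFactor_rpow_slice (hc1 : IsCMField.complexConj L ≠ 1)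
    (hIw : ∀ g : (quasiSplit (↥(maximalRealSubfield L)) L (IsCMField.complexConj L) 3).Adelic, ∃ b ∈ borelAdelic ↥(maximalRealSubfield L) L (IsCMField.complexConj L) 3, ∃ k : (quasiSplit (↥(maximalRealSubfield L)) L (IsCMField.complexConj L) 3).Adelic,
      adelicVal ↥(maximalRealSubfield L) L (IsCMField.complexConj L) 3 ((StdForm.antidiagonal 3).over L) k ∈ standardMaximalCompactGL 3 L ∧ g = b * k)
    {σ : ℝ} (hσ : 2 < σ) (X : AdeleRing (𝓞 L) L) :
    Integrable (fun b : FiniteAdeleRing (𝓞 ↥(maximalRealSubfield L)) ↥(maximalRealSubfield L) => ((((∏ᶠ w : HeightOneSpectrum (𝓞 L), max 1 (max ‖((X) : AdeleRing (𝓞 L) L).2 w‖₊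
              ‖(heisZ (c := IsCMField.complexConj L) ((X) : AdeleRing (𝓞 L) L)
                ((traceZeroLine ↥(maximalRealSubfield L) L (IsCMField.complexConj L) hcδ hδ ((0, b) : AdeleRing (𝓞 ↥(maximalRealSubfield L)) ↥(maximalRealSubfield L)) : traceZeroAdele ↥(maximalRealSubfield L) L (IsCMField.complexConj L)) : AdeleRing (𝓞 L) L)).2 w‖₊) : ℝ≥0) : ℝ) ^ (-σ) : ℝ) : ℂ)) μF₂ := by
  haveI : SecondCountableTopology (InfiniteAdeleRing ↥(maximalRealSubfield L)) := secondCountableTopology_infiniteAdeleRing _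
  haveI : SecondCountableTopology (FiniteAdeleRing (𝓞 ↥(maximalRealSubfield L)) ↥(maximalRealSubfield L)) := secondCountableTopology_finiteAdeleRing _
  haveI : LocallyCompactSpace (FiniteAdeleRing (𝓞 ↥(maximalRealSubfield L)) ↥(maximalRealSubfield L)) := locallyCompactSpace_finiteAdeleRing' _
  obtain ⟨s, hs⟩ := ((integrable_prod_centreLine L hc hcδ hδ μF μF₁ μF₂ hc1 hIw hσ X).prod_right_ae (μ := μF₁) (ν := μF₂)).exists
  exact (integrable_const_mul_iff (isUnit_iff_ne_zero.2 (arch_rpow_ne_zero L σ X.1 ((InfiniteAdeleRing.ringEquiv_mixedSpace ↥(maximalRealSubfield L)) s))) _).1 hs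

include hc hcδ hδ μF μF₂ in
/-- **`s_∞ ↦ ARCH(X_∞, ι s_∞)^{−σ}` IS `μ_{F,∞}`-INTEGRABLE FOR EVERY `X`** (a.e. `b`-slice of §2's product integrability, the finite factor being a nonzero constant on the slice).
[cite: MoeglinWaldspurger1995, II.1.7] -/
theorem integrable_arch_rpow_slice (hc1 : IsCMField.complexConj L ≠ 1)
    (hIw : ∀ g : (quasiSplit (↥(maximalRealSubfield L)) L (IsCMField.complexConj L) 3).Adelic, ∃ b ∈ borelAdelic ↥(maximalRealSubfield L) L (IsCMField.complexConj L) 3, ∃ k : (quasiSplit (↥(maximalRealSubfield L)) L (IsCMField.complexConj L) 3).Adelic,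
      adelicVal ↥(maximalRealSubfield L) L (IsCMField.complexConj L) 3 ((StdForm.antidiagonal 3).over L) k ∈ standardMaximalCompactGL 3 L ∧ g = b * k)
    {σ : ℝ} (hσ : 2 < σ) (X : AdeleRing (𝓞 L) L) :
    Integrable (fun a : InfiniteAdeleRing ↥(maximalRealSubfield L) => ((((∏ w : InfinitePlace L, ((1 + ‖(X.1) w‖ ^ 2 / 2) ^ 2 + (w δ) ^ 2 * (((InfiniteAdeleRing.ringEquiv_mixedSpace ↥(maximalRealSubfield L)) a).1 ⟨w.comap (algebraMap ↥(maximalRealSubfield L) L), K2E1HeightBigCellLineFormulaU2.isReal_comap_maximalRealSubfield L w⟩) ^ 2))) ^ (-σ) : ℝ) : ℂ)) μF₁ := by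
  haveI : SecondCountableTopology (InfiniteAdeleRing ↥(maximalRealSubfield L)) := secondCountableTopology_infiniteAdeleRing _
  haveI : SecondCountableTopology (FiniteAdeleRing (𝓞 ↥(maximalRealSubfield L)) ↥(maximalRealSubfield L)) := secondCountableTopology_finiteAdeleRing _
  haveI : LocallyCompactSpace (FiniteAdeleRing (𝓞 ↥(maximalRealSubfield L)) ↥(maximalRealSubfield L)) := locallyCompactSpace_finiteAdeleRing' _
  obtain ⟨b, hb⟩ := ((integrable_prod_centreLine L hc hcδ hδ μF μF₁ μF₂ hc1 hIw hσ X).prod_left_ae (μ := μF₁) (ν := μF₂)).exists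
  exact (integrable_mul_const_iff (isUnit_iff_ne_zero.2 (heightFactor_rpow_ne_zero L hcδ hδ σ X b)) _).1 hb

include hc hcδ hδ μF μF₂ in
/-- **The archimedean slice integral is positive**: `0 < ∫ ‖ARCH(X_∞, ι s_∞)^{−σ}‖ dμ_{F,∞}` (integrable by the previous lemma, positive integrand, `μ_{F,∞} ≠ 0`). [folklore] -/
theorem integral_norm_arch_rpow_pos (hc1 : IsCMField.complexConj L ≠ 1)
    (hIw : ∀ g : (quasiSplit (↥(maximalRealSubfield L)) L (IsCMField.complexConj L) 3).Adelic, ∃ b ∈ borelAdelic ↥(maximalRealSubfield L) L (IsCMField.complexConj L) 3, ∃ k : (quasiSplit (↥(maximalRealSubfield L)) L (IsCMField.complexConj L) 3).Adelic,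
      adelicVal ↥(maximalRealSubfield L) L (IsCMField.complexConj L) 3 ((StdForm.antidiagonal 3).over L) k ∈ standardMaximalCompactGL 3 L ∧ g = b * k)
    {σ : ℝ} (hσ : 2 < σ) (X : AdeleRing (𝓞 L) L) :
    0 < ∫ a : InfiniteAdeleRing ↥(maximalRealSubfield L), ‖((((∏ w : InfinitePlace L, ((1 + ‖(X.1) w‖ ^ 2 / 2) ^ 2 + (w δ) ^ 2 * (((InfiniteAdeleRing.ringEquiv_mixedSpace ↥(maximalRealSubfield L)) a).1 ⟨w.comap (algebraMap ↥(maximalRealSubfield L) L), K2E1HeightBigCellLineFormulaU2.isReal_comap_maximalRealSubfield L w⟩) ^ 2))) ^ (-σ) : ℝ) : ℂ)‖ ∂μF₁ := by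
  have hint := (integrable_arch_rpow_slice L hc hcδ hδ μF μF₁ μF₂ hc1 hIw hσ X).norm
  rw [integral_pos_iff_support_of_nonneg (fun a => norm_nonneg _) hint]
  have hsupp : Function.support (fun a : InfiniteAdeleRing ↥(maximalRealSubfield L) => ‖((((∏ w : InfinitePlace L, ((1 + ‖(X.1) w‖ ^ 2 / 2) ^ 2 + (w δ) ^ 2 * (((InfiniteAdeleRing.ringEquiv_mixedSpace ↥(maximalRealSubfield L)) a).1 ⟨w.comap (algebraMap ↥(maximalRealSubfield L) L), K2E1HeightBigCellLineFormulaU2.isReal_comap_maximalRealSubfield L w⟩) ^ 2))) ^ (-σ) : ℝ) : ℂ)‖) = Set.univ :=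
    Set.eq_univ_of_forall fun a => Function.mem_support.2 (norm_ne_zero_iff.2 (arch_rpow_ne_zero L σ X.1 ((InfiniteAdeleRing.ringEquiv_mixedSpace ↥(maximalRealSubfield L)) a)))
  rw [hsupp]
  exact measure_univ_pos.2 (NeZero.ne μF₁)

/-! ## §3 The norm integral along the centre line factors, at EVERY `X` -/

include hc in
omit [BorelSpace (AdeleRing (𝓞 ↥(maximalRealSubfield L)) ↥(maximalRealSubfield L))] [BorelSpace (InfiniteAdeleRing ↥(maximalRealSubfield L))]
  [BorelSpace (FiniteAdeleRing (𝓞 ↥(maximalRealSubfield L)) ↥(maximalRealSubfield L))] [μF.IsAddHaarMeasure] in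
/-- **`∫ ‖Φ(X, s)‖ dμ_F(s) = c_F · (∫ ‖ARCH(X_∞, ι s_∞)^{−σ}‖ dμ_{F,∞}) · (∫ ‖h_f((0, X_f), b)^{−σ}‖ dμ_{F,f})`** for every `X` and the ONE constant `c_F > 0` of
★ `exists_integral_adele_eq_smul_integral_prod` (no integrability needed: Mathlib `integral_prod_mul`; the finite factor depends on `X` only through `X_f`, definitionally).
[cite: CasselsFrohlichANT1967, Ch. XV §3.3] -/
theorem integral_norm_centreLine_eq (σ : ℝ) {cF : ℝ≥0}
    (hF : ∀ G : InfiniteAdeleRing ↥(maximalRealSubfield L) → FiniteAdeleRing (𝓞 ↥(maximalRealSubfield L)) ↥(maximalRealSubfield L) → ℂ,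
      ∫ v, G v.1 v.2 ∂μF = (cF : ℝ) • ∫ p : InfiniteAdeleRing ↥(maximalRealSubfield L) × FiniteAdeleRing (𝓞 ↥(maximalRealSubfield L)) ↥(maximalRealSubfield L), G p.1 p.2 ∂(μF₁.prod μF₂))
    (X : AdeleRing (𝓞 L) L) :
    ∫ s : AdeleRing (𝓞 ↥(maximalRealSubfield L)) ↥(maximalRealSubfield L), ‖((((borelHeight (((quasiSplit (↥(maximalRealSubfield L)) L (IsCMField.complexConj L) 3).toAdelic (weylLongU ((IsCMField.complexConj L : L ≃ₐ[↥(maximalRealSubfield L)] L) : L →+* L) (rfl : ((StdForm.antidiagonal 3).over L) = ((StdForm.antidiagonal 3).over L)))) * (((heisChart hc (X, traceZeroLine ↥(maximalRealSubfield L) L (IsCMField.complexConj L) hcδ hδ s)) : ↥(adelicUnipotent ↥(maximalRealSubfield L) L (IsCMField.complexConj L) 3)) : (quasiSplit (↥(maximalRealSubfield L)) L (IsCMField.complexConj L) 3).Adelic))) : ℝ) ^ σ : ℝ) : ℂ)‖ ∂μF =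
      (cF : ℝ) * (∫ a : InfiniteAdeleRing ↥(maximalRealSubfield L), ‖((((∏ w : InfinitePlace L, ((1 + ‖(X.1) w‖ ^ 2 / 2) ^ 2 + (w δ) ^ 2 * (((InfiniteAdeleRing.ringEquiv_mixedSpace ↥(maximalRealSubfield L)) a).1 ⟨w.comap (algebraMap ↥(maximalRealSubfield L) L), K2E1HeightBigCellLineFormulaU2.isReal_comap_maximalRealSubfield L w⟩) ^ 2))) ^ (-σ) : ℝ) : ℂ)‖ ∂μF₁) *
        ∫ b : FiniteAdeleRing (𝓞 ↥(maximalRealSubfield L)) ↥(maximalRealSubfield L), ‖((((∏ᶠ w : HeightOneSpectrum (𝓞 L), max 1 (max ‖((((0 : InfiniteAdeleRing L)), X.2) : AdeleRing (𝓞 L) L).2 w‖₊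
              ‖(heisZ (c := IsCMField.complexConj L) ((((0 : InfiniteAdeleRing L)), X.2) : AdeleRing (𝓞 L) L)
                ((traceZeroLine ↥(maximalRealSubfield L) L (IsCMField.complexConj L) hcδ hδ ((0, b) : AdeleRing (𝓞 ↥(maximalRealSubfield L)) ↥(maximalRealSubfield L)) : traceZeroAdele ↥(maximalRealSubfield L) L (IsCMField.complexConj L)) : AdeleRing (𝓞 L) L)).2 w‖₊) : ℝ≥0) : ℝ) ^ (-σ) : ℝ) : ℂ)‖ ∂μF₂ := by
  haveI : SecondCountableTopology (InfiniteAdeleRing ↥(maximalRealSubfield L)) := secondCountableTopology_infiniteAdeleRing _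
  haveI : SecondCountableTopology (FiniteAdeleRing (𝓞 ↥(maximalRealSubfield L)) ↥(maximalRealSubfield L)) := secondCountableTopology_finiteAdeleRing _
  haveI : LocallyCompactSpace (FiniteAdeleRing (𝓞 ↥(maximalRealSubfield L)) ↥(maximalRealSubfield L)) := locallyCompactSpace_finiteAdeleRing' _
  apply Complex.ofReal_injective
  rw [← integral_complex_ofReal]
  have hpt : (fun s : AdeleRing (𝓞 ↥(maximalRealSubfield L)) ↥(maximalRealSubfield L) => ((‖((((borelHeight (((quasiSplit (↥(maximalRealSubfield L)) L (IsCMField.complexConj L) 3).toAdelic (weylLongU ((IsCMField.complexConj L : L ≃ₐ[↥(maximalRealSubfield L)] L) : L →+* L) (rfl : ((StdForm.antidiagonal 3).over L) = ((StdForm.antidiagonal 3).over L)))) * (((heisChart hc (X, traceZeroLine ↥(maximalRealSubfield L) L (IsCMField.complexConj L) hcδ hδ s)) : ↥(adelicUnipotent ↥(maximalRealSubfield L) L (IsCMField.complexConj L) 3)) : (quasiSplit (↥(maximalRealSubfield L)) L (IsCMField.complexConj L) 3).Adelic))) : ℝ) ^ σ : ℝ) : ℂ)‖ : ℝ) : ℂ))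 =
      fun s => ((‖((((∏ w : InfinitePlace L, ((1 + ‖(X.1) w‖ ^ 2 / 2) ^ 2 + (w δ) ^ 2 * (((InfiniteAdeleRing.ringEquiv_mixedSpace ↥(maximalRealSubfield L)) s.1).1 ⟨w.comap (algebraMap ↥(maximalRealSubfield L) L), K2E1HeightBigCellLineFormulaU2.isReal_comap_maximalRealSubfield L w⟩) ^ 2))) ^ (-σ) : ℝ) : ℂ) *
        ((((∏ᶠ w : HeightOneSpectrum (𝓞 L), max 1 (max ‖((X) : AdeleRing (𝓞 L) L).2 w‖₊
              ‖(heisZ (c := IsCMField.complexConj L) ((X) : AdeleRing (𝓞 L) L)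
                ((traceZeroLine ↥(maximalRealSubfield L) L (IsCMField.complexConj L) hcδ hδ ((0, s.2) : AdeleRing (𝓞 ↥(maximalRealSubfield L)) ↥(maximalRealSubfield L)) : traceZeroAdele ↥(maximalRealSubfield L) L (IsCMField.complexConj L)) : AdeleRing (𝓞 L) L)).2 w‖₊) : ℝ≥0) : ℝ) ^ (-σ) : ℝ) : ℂ)‖ : ℝ) : ℂ) :=
    funext fun s => by rw [rpow_borelHeight_weylLongU_heisChart_eq L hc hcδ hδ σ X s]
  rw [hpt, hF (fun a b => ((‖((((∏ w : InfinitePlace L, ((1 + ‖(X.1) w‖ ^ 2 / 2) ^ 2 + (w δ) ^ 2 * (((InfiniteAdeleRing.ringEquiv_mixedSpace ↥(maximalRealSubfield L)) a).1 ⟨w.comap (algebraMap ↥(maximalRealSubfield L) L), K2E1HeightBigCellLineFormulaU2.isReal_comap_maximalRealSubfield L w⟩) ^ 2))) ^ (-σ) : ℝ) : ℂ) *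
        ((((∏ᶠ w : HeightOneSpectrum (𝓞 L), max 1 (max ‖((X) : AdeleRing (𝓞 L) L).2 w‖₊
              ‖(heisZ (c := IsCMField.complexConj L) ((X) : AdeleRing (𝓞 L) L)
                ((traceZeroLine ↥(maximalRealSubfield L) L (IsCMField.complexConj L) hcδ hδ ((0, b) : AdeleRing (𝓞 ↥(maximalRealSubfield L)) ↥(maximalRealSubfield L)) : traceZeroAdele ↥(maximalRealSubfield L) L (IsCMField.complexConj L)) : AdeleRing (𝓞 L) L)).2 w‖₊) : ℝ≥0) : ℝ) ^ (-σ) : ℝ) : ℂ)‖ : ℝ) : ℂ))]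
  simp_rw [norm_mul, Complex.ofReal_mul]
  rw [integral_prod_mul (μ := μF₁) (ν := μF₂) (fun a : InfiniteAdeleRing ↥(maximalRealSubfield L) => ((‖((((∏ w : InfinitePlace L, ((1 + ‖(X.1) w‖ ^ 2 / 2) ^ 2 + (w δ) ^ 2 * (((InfiniteAdeleRing.ringEquiv_mixedSpace ↥(maximalRealSubfield L)) a).1 ⟨w.comap (algebraMap ↥(maximalRealSubfield L) L), K2E1HeightBigCellLineFormulaU2.isReal_comap_maximalRealSubfield L w⟩) ^ 2))) ^ (-σ) : ℝ) : ℂ)‖ : ℝ) : ℂ))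
    (fun b : FiniteAdeleRing (𝓞 ↥(maximalRealSubfield L)) ↥(maximalRealSubfield L) => ((‖((((∏ᶠ w : HeightOneSpectrum (𝓞 L), max 1 (max ‖((X) : AdeleRing (𝓞 L) L).2 w‖₊
              ‖(heisZ (c := IsCMField.complexConj L) ((X) : AdeleRing (𝓞 L) L)
                ((traceZeroLine ↥(maximalRealSubfield L) L (IsCMField.complexConj L) hcδ hδ ((0, b) : AdeleRing (𝓞 ↥(maximalRealSubfield L)) ↥(maximalRealSubfield L)) : traceZeroAdele ↥(maximalRealSubfield L) L (IsCMField.complexConj L)) : AdeleRing (𝓞 L) L)).2 w‖₊) : ℝ≥0) : ℝ) ^ (-σ) : ℝ) : ℂ)‖ : ℝ) : ℂ)),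
    integral_complex_ofReal, integral_complex_ofReal, Complex.real_smul]
  rw [mul_assoc]
  rfl

end Slices

/-! ## §4 HEAD: `hT ⟹ hfin` -/

include hc in
/-- **THE FINITE PART OF `H(ι(w₀)·)^σ` IS INTEGRABLE** (`σ > 2`): if `v ↦ H(ι(w₀)·v)^σ` is `ν`-integrable on `N(𝔸_{L⁺})` (`hT`), then
`(X_f, b) ↦ ((h_f((0, X_f), b)^{−σ} : ℝ) : ℂ)` is `μ_{E,f} ⊗ μ_{F,f}`-integrable — the letter `hfin` of ★ (3-iv-c).  (★ (ν-1) :93 ⟹ `Φ ∈ L¹(μ_E ⊗ μ_F)` ⟹ `X ↦ ∫‖Φ(X,·)‖ ∈ L¹(μ_E)`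
(`Integrable.integral_norm_prod_left`) = `c_F·I(X_∞)·J(X_f)` (§3) ⟹ `J ∈ L¹(μ_{E,f})` (★ `integrable_iff_integrable_prod` on `𝔸_L`, `prod_right_ae`, `I > 0` §2) ⟹ `integrable_prod_iff` with §1–§2.)
[cite: MoeglinWaldspurger1995, II.1.6–II.1.7] [cite: CasselsFrohlichANT1967, Ch. XV §3.3] -/
theorem integrable_prod_heightFactor_rpow_of_integrable (hc1 : IsCMField.complexConj L ≠ 1)
    (hIw : ∀ g : (quasiSplit (↥(maximalRealSubfield L)) L (IsCMField.complexConj L) 3).Adelic, ∃ b ∈ borelAdelic ↥(maximalRealSubfield L) L (IsCMField.complexConj L) 3, ∃ k : (quasiSplit (↥(maximalRealSubfield L)) L (IsCMField.complexConj L) 3).Adelic,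
      adelicVal ↥(maximalRealSubfield L) L (IsCMField.complexConj L) 3 ((StdForm.antidiagonal 3).over L) k ∈ standardMaximalCompactGL 3 L ∧ g = b * k)
    [MeasurableSpace ↥(adelicUnipotent ↥(maximalRealSubfield L) L (IsCMField.complexConj L) 3)] [BorelSpace ↥(adelicUnipotent ↥(maximalRealSubfield L) L (IsCMField.complexConj L) 3)]
    [MeasurableSpace (AdeleRing (𝓞 L) L)] [BorelSpace (AdeleRing (𝓞 L) L)]
    [MeasurableSpace (AdeleRing (𝓞 ↥(maximalRealSubfield L)) ↥(maximalRealSubfield L))] [BorelSpace (AdeleRing (𝓞 ↥(maximalRealSubfield L)) ↥(maximalRealSubfield L))]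
    [MeasurableSpace (InfiniteAdeleRing L)] [BorelSpace (InfiniteAdeleRing L)]
    [MeasurableSpace (InfiniteAdeleRing ↥(maximalRealSubfield L))] [BorelSpace (InfiniteAdeleRing ↥(maximalRealSubfield L))]
    [MeasurableSpace (FiniteAdeleRing (𝓞 L) L)] [BorelSpace (FiniteAdeleRing (𝓞 L) L)]
    [MeasurableSpace (FiniteAdeleRing (𝓞 ↥(maximalRealSubfield L)) ↥(maximalRealSubfield L))] [BorelSpace (FiniteAdeleRing (𝓞 ↥(maximalRealSubfield L)) ↥(maximalRealSubfield L))]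
    (ν : Measure ↥(adelicUnipotent ↥(maximalRealSubfield L) L (IsCMField.complexConj L) 3)) [ν.IsHaarMeasure]
    (μE : Measure (AdeleRing (𝓞 L) L)) [μE.IsAddHaarMeasure] (μE₁ : Measure (InfiniteAdeleRing L)) [μE₁.IsAddHaarMeasure]
    (μE₂ : Measure (FiniteAdeleRing (𝓞 L) L)) [μE₂.IsAddHaarMeasure]
    (μF : Measure (AdeleRing (𝓞 ↥(maximalRealSubfield L)) ↥(maximalRealSubfield L))) [μF.IsAddHaarMeasure] (μF₁ : Measure (InfiniteAdeleRing ↥(maximalRealSubfield L))) [μF₁.IsAddHaarMeasure]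
    (μF₂ : Measure (FiniteAdeleRing (𝓞 ↥(maximalRealSubfield L)) ↥(maximalRealSubfield L))) [μF₂.IsAddHaarMeasure]
    {σ : ℝ} (hσ : 2 < σ)
    (hT : Integrable (fun v : ↥(adelicUnipotent ↥(maximalRealSubfield L) L (IsCMField.complexConj L) 3) =>
      ((((borelHeight (((quasiSplit (↥(maximalRealSubfield L)) L (IsCMField.complexConj L) 3).toAdelic (weylLongU ((IsCMField.complexConj L : L ≃ₐ[↥(maximalRealSubfield L)] L) : L →+* L) (rfl : ((StdForm.antidiagonal 3).over L) = ((StdForm.antidiagonal 3).over L)))) * (v : (quasiSplit (↥(maximalRealSubfield L)) L (IsCMField.complexConj L) 3).Adelic))) : ℝ) ^ σ : ℝ) : ℂ)) ν) :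
    Integrable (fun q : FiniteAdeleRing (𝓞 L) L × FiniteAdeleRing (𝓞 ↥(maximalRealSubfield L)) ↥(maximalRealSubfield L) =>
      ((((∏ᶠ w : HeightOneSpectrum (𝓞 L), max 1 (max ‖((((0 : InfiniteAdeleRing L)), q.1) : AdeleRing (𝓞 L) L).2 w‖₊
              ‖(heisZ (c := IsCMField.complexConj L) ((((0 : InfiniteAdeleRing L)), q.1) : AdeleRing (𝓞 L) L)
                ((traceZeroLine ↥(maximalRealSubfield L) L (IsCMField.complexConj L) hcδ hδ ((0, q.2) : AdeleRing (𝓞 ↥(maximalRealSubfield L)) ↥(maximalRealSubfield L)) : traceZeroAdele ↥(maximalRealSubfield L) L (IsCMField.complexConj L)) : AdeleRing (𝓞 L) L)).2 w‖₊) : ℝ≥0) : ℝ) ^ (-σ) : ℝ) : ℂ)) (μE₂.prod μF₂) := by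
  haveI : SecondCountableTopology (FiniteAdeleRing (𝓞 ↥(maximalRealSubfield L)) ↥(maximalRealSubfield L)) := secondCountableTopology_finiteAdeleRing _
  haveI : LocallyCompactSpace (FiniteAdeleRing (𝓞 ↥(maximalRealSubfield L)) ↥(maximalRealSubfield L)) := locallyCompactSpace_finiteAdeleRing' _
  haveI : SecondCountableTopology (FiniteAdeleRing (𝓞 L) L) := secondCountableTopology_finiteAdeleRing L
  haveI : LocallyCompactSpace (FiniteAdeleRing (𝓞 L) L) := locallyCompactSpace_finiteAdeleRing' L
  haveI : SecondCountableTopology (InfiniteAdeleRing L) := secondCountableTopology_infiniteAdeleRing L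
  haveI : SecondCountableTopology (InfiniteAdeleRing ↥(maximalRealSubfield L)) := secondCountableTopology_infiniteAdeleRing _
  haveI := secondCountableTopology_adeleRing ↥(maximalRealSubfield L)
  haveI := locallyCompactSpace_adeleRing' ↥(maximalRealSubfield L)
  obtain ⟨cF, hcF, hF⟩ := exists_integral_adele_eq_smul_integral_prod ↥(maximalRealSubfield L) μF μF₁ μF₂
  -- `Φ ∈ L¹(μ_E ⊗ μ_F)` (★ (ν-1) :93) and the norm marginal `X ↦ ∫ ‖Φ(X,·)‖ dμ_F ∈ L¹(μ_E)`
  have hΦ := (integrable_comp_heisChart_traceZeroLine_prod_iff_three hcδ hδ hc μF μE ν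
    (fun v : ↥(adelicUnipotent ↥(maximalRealSubfield L) L (IsCMField.complexConj L) 3) => ((((borelHeight (((quasiSplit (↥(maximalRealSubfield L)) L (IsCMField.complexConj L) 3).toAdelic (weylLongU ((IsCMField.complexConj L : L ≃ₐ[↥(maximalRealSubfield L)] L) : L →+* L) (rfl : ((StdForm.antidiagonal 3).over L) = ((StdForm.antidiagonal 3).over L)))) * (v : (quasiSplit (↥(maximalRealSubfield L)) L (IsCMField.complexConj L) 3).Adelic))) : ℝ) ^ σ : ℝ) : ℂ))).2 hT
  have hN := hΦ.integral_norm_prod_left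
  -- §3: the norm marginal is `c_F · I(X_∞) · J(X_f)`
  have hNeq : (fun X : AdeleRing (𝓞 L) L => ∫ s : AdeleRing (𝓞 ↥(maximalRealSubfield L)) ↥(maximalRealSubfield L),
      ‖((((borelHeight (((quasiSplit (↥(maximalRealSubfield L)) L (IsCMField.complexConj L) 3).toAdelic (weylLongU ((IsCMField.complexConj L : L ≃ₐ[↥(maximalRealSubfield L)] L) : L →+* L) (rfl : ((StdForm.antidiagonal 3).over L) = ((StdForm.antidiagonal 3).over L)))) * (((heisChart hc (X, traceZeroLine ↥(maximalRealSubfield L) L (IsCMField.complexConj L) hcδ hδ s)) : ↥(adelicUnipotent ↥(maximalRealSubfield L) L (IsCMField.complexConj L) 3)) : (quasiSplit (↥(maximalRealSubfield L)) L (IsCMField.complexConj L) 3).Adelic))) : ℝ) ^ σ : ℝ) : ℂ)‖ ∂μF) =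
      fun X => (cF : ℝ) * (∫ a : InfiniteAdeleRing ↥(maximalRealSubfield L), ‖((((∏ w : InfinitePlace L, ((1 + ‖(X.1) w‖ ^ 2 / 2) ^ 2 + (w δ) ^ 2 * (((InfiniteAdeleRing.ringEquiv_mixedSpace ↥(maximalRealSubfield L)) a).1 ⟨w.comap (algebraMap ↥(maximalRealSubfield L) L), K2E1HeightBigCellLineFormulaU2.isReal_comap_maximalRealSubfield L w⟩) ^ 2))) ^ (-σ) : ℝ) : ℂ)‖ ∂μF₁) *
        ∫ b : FiniteAdeleRing (𝓞 ↥(maximalRealSubfield L)) ↥(maximalRealSubfield L), ‖((((∏ᶠ w : HeightOneSpectrum (𝓞 L), max 1 (max ‖((((0 : InfiniteAdeleRing L)), X.2) : AdeleRing (𝓞 L) L).2 w‖₊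
              ‖(heisZ (c := IsCMField.complexConj L) ((((0 : InfiniteAdeleRing L)), X.2) : AdeleRing (𝓞 L) L)
                ((traceZeroLine ↥(maximalRealSubfield L) L (IsCMField.complexConj L) hcδ hδ ((0, b) : AdeleRing (𝓞 ↥(maximalRealSubfield L)) ↥(maximalRealSubfield L)) : traceZeroAdele ↥(maximalRealSubfield L) L (IsCMField.complexConj L)) : AdeleRing (𝓞 L) L)).2 w‖₊) : ℝ≥0) : ℝ) ^ (-σ) : ℝ) : ℂ)‖ ∂μF₂ :=
    funext fun X => integral_norm_centreLine_eq L hc hcδ hδ μF μF₁ μF₂ σ hF X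
  rw [hNeq] at hN
  -- transfer to `μ_{E,∞} ⊗ μ_{E,f}` (★ `integrable_iff_integrable_prod` on `𝔸_L`, in `ℂ`) and take an a.e. `X_∞`-slice
  have hNC : Integrable (fun X : AdeleRing (𝓞 L) L => (((cF : ℝ) * (∫ a : InfiniteAdeleRing ↥(maximalRealSubfield L), ‖((((∏ w : InfinitePlace L, ((1 + ‖(X.1) w‖ ^ 2 / 2) ^ 2 + (w δ) ^ 2 * (((InfiniteAdeleRing.ringEquiv_mixedSpace ↥(maximalRealSubfield L)) a).1 ⟨w.comap (algebraMap ↥(maximalRealSubfield L) L), K2E1HeightBigCellLineFormulaU2.isReal_comap_maximalRealSubfield L w⟩) ^ 2))) ^ (-σ) : ℝ) : ℂ)‖ ∂μF₁) *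
        ∫ b : FiniteAdeleRing (𝓞 ↥(maximalRealSubfield L)) ↥(maximalRealSubfield L), ‖((((∏ᶠ w : HeightOneSpectrum (𝓞 L), max 1 (max ‖((((0 : InfiniteAdeleRing L)), X.2) : AdeleRing (𝓞 L) L).2 w‖₊
              ‖(heisZ (c := IsCMField.complexConj L) ((((0 : InfiniteAdeleRing L)), X.2) : AdeleRing (𝓞 L) L)
                ((traceZeroLine ↥(maximalRealSubfield L) L (IsCMField.complexConj L) hcδ hδ ((0, b) : AdeleRing (𝓞 ↥(maximalRealSubfield L)) ↥(maximalRealSubfield L)) : traceZeroAdele ↥(maximalRealSubfield L) L (IsCMField.complexConj L)) : AdeleRing (𝓞 L) L)).2 w‖₊) : ℝ≥0) : ℝ) ^ (-σ) : ℝ) : ℂ)‖ ∂μF₂ : ℝ) : ℂ)) μE :=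
    Complex.ofRealCLM.integrable_comp hN
  have hNc := (K2E1AdelicFourierEnvelope.integrable_iff_integrable_prod L μE μE₁ μE₂ _).1 hNC
  obtain ⟨x1, hx1⟩ := (hNc.prod_right_ae (μ := μE₁) (ν := μE₂)).exists
  have hI : 0 < (cF : ℝ) * ∫ a : InfiniteAdeleRing ↥(maximalRealSubfield L), ‖((((∏ w : InfinitePlace L, ((1 + ‖(x1) w‖ ^ 2 / 2) ^ 2 + (w δ) ^ 2 * (((InfiniteAdeleRing.ringEquiv_mixedSpace ↥(maximalRealSubfield L)) a).1 ⟨w.comap (algebraMap ↥(maximalRealSubfield L) L), K2E1HeightBigCellLineFormulaU2.isReal_comap_maximalRealSubfield L w⟩) ^ 2))) ^ (-σ) : ℝ) : ℂ)‖ ∂μF₁ :=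
    mul_pos (NNReal.coe_pos.2 hcF) (integral_norm_arch_rpow_pos L hc hcδ hδ μF μF₁ μF₂ hc1 hIw hσ ((x1, 0) : AdeleRing (𝓞 L) L))
  have hJc : Integrable (fun x2 : FiniteAdeleRing (𝓞 L) L =>
      ((∫ b : FiniteAdeleRing (𝓞 ↥(maximalRealSubfield L)) ↥(maximalRealSubfield L), ‖((((∏ᶠ w : HeightOneSpectrum (𝓞 L), max 1 (max ‖((((0 : InfiniteAdeleRing L)), x2) : AdeleRing (𝓞 L) L).2 w‖₊
              ‖(heisZ (c := IsCMField.complexConj L) ((((0 : InfiniteAdeleRing L)), x2) : AdeleRing (𝓞 L) L)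
                ((traceZeroLine ↥(maximalRealSubfield L) L (IsCMField.complexConj L) hcδ hδ ((0, b) : AdeleRing (𝓞 ↥(maximalRealSubfield L)) ↥(maximalRealSubfield L)) : traceZeroAdele ↥(maximalRealSubfield L) L (IsCMField.complexConj L)) : AdeleRing (𝓞 L) L)).2 w‖₊) : ℝ≥0) : ℝ) ^ (-σ) : ℝ) : ℂ)‖ ∂μF₂ : ℝ) : ℂ)) μE₂ := by
    refine (integrable_const_mul_iff (isUnit_iff_ne_zero.2 (?_ : (((cF : ℝ) * ∫ a : InfiniteAdeleRing ↥(maximalRealSubfield L),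
      ‖((((∏ w : InfinitePlace L, ((1 + ‖(x1) w‖ ^ 2 / 2) ^ 2 + (w δ) ^ 2 * (((InfiniteAdeleRing.ringEquiv_mixedSpace ↥(maximalRealSubfield L)) a).1 ⟨w.comap (algebraMap ↥(maximalRealSubfield L) L), K2E1HeightBigCellLineFormulaU2.isReal_comap_maximalRealSubfield L w⟩) ^ 2))) ^ (-σ) : ℝ) : ℂ)‖ ∂μF₁ : ℝ) : ℂ) ≠ 0)) _).1 (hx1.congr (Eventually.of_forall fun x2 => ?_))
    · exact_mod_cast hI.ne'
    · dsimp only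
      push_cast
      ring
  have hJ : Integrable (fun x2 : FiniteAdeleRing (𝓞 L) L =>
      ∫ b : FiniteAdeleRing (𝓞 ↥(maximalRealSubfield L)) ↥(maximalRealSubfield L), ‖((((∏ᶠ w : HeightOneSpectrum (𝓞 L), max 1 (max ‖((((0 : InfiniteAdeleRing L)), x2) : AdeleRing (𝓞 L) L).2 w‖₊
              ‖(heisZ (c := IsCMField.complexConj L) ((((0 : InfiniteAdeleRing L)), x2) : AdeleRing (𝓞 L) L)
                ((traceZeroLine ↥(maximalRealSubfield L) L (IsCMField.complexConj L) hcδ hδ ((0, b) : AdeleRing (𝓞 ↥(maximalRealSubfield L)) ↥(maximalRealSubfield L)) : traceZeroAdele ↥(maximalRealSubfield L) L (IsCMField.complexConj L)) : AdeleRing (𝓞 L) L)).2 w‖₊) : ℝ≥0) : ℝ) ^ (-σ) : ℝ) : ℂ)‖ ∂μF₂) μE₂ :=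
    hJc.re
  -- `integrable_prod_iff`: slices from §2 (every `X_f`), norm marginal `hJ`, measurability §1
  refine (integrable_prod_iff (aestronglyMeasurable_heightFactor_rpow L hc hcδ hδ σ (μE₂.prod μF₂))).2 ⟨Eventually.of_forall fun x2 => ?_, hJ⟩
  exact integrable_heightFactor_rpow_slice L hc hcδ hδ μF μF₁ μF₂ hc1 hIw hσ ((0, x2) : AdeleRing (𝓞 L) L)

include hc in
/-- **R7₃-SCALAR WITHOUT THE FINITE-INTEGRABILITY LETTER**: ★ (3-iv-c) `exists_pos_inv_measure_smul_integral_rpow_borelHeight_eq_eulerProduct_three` with `hfin` discharged by §4 —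
`(ν𝓕)⁻¹ • ∫_{N(𝔸)} H(ι(w₀)·v)^σ dν = C · ARCH(σ) · (∏_{v ∈ S₀} a_v(σ)) · N^{S₀}(σ)∕D^{S₀}(σ)` for every `σ > 2` under `hT` (Godement), `hgood`, `hc`, `hc1`, `hIw`, `h𝓕` only.
[cite: MoeglinWaldspurger1995, II.1.7] [cite: Langlands1971, §3] [cite: Rogawski1990, §7.3] -/
theorem exists_pos_inv_measure_smul_integral_rpow_borelHeight_eq_eulerProduct_three' (hc1 : IsCMField.complexConj L ≠ 1)
    (hIw : ∀ g : (quasiSplit (↥(maximalRealSubfield L)) L (IsCMField.complexConj L) 3).Adelic, ∃ b ∈ borelAdelic ↥(maximalRealSubfield L) L (IsCMField.complexConj L) 3, ∃ k : (quasiSplit (↥(maximalRealSubfield L)) L (IsCMField.complexConj L) 3).Adelic,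
      adelicVal ↥(maximalRealSubfield L) L (IsCMField.complexConj L) 3 ((StdForm.antidiagonal 3).over L) k ∈ standardMaximalCompactGL 3 L ∧ g = b * k)
    {d : ↥(maximalRealSubfield L)} (hd : δ * δ = algebraMap ↥(maximalRealSubfield L) L d)
    [MeasurableSpace ↥(adelicUnipotent ↥(maximalRealSubfield L) L (IsCMField.complexConj L) 3)] [BorelSpace ↥(adelicUnipotent ↥(maximalRealSubfield L) L (IsCMField.complexConj L) 3)]
    [MeasurableSpace (AdeleRing (𝓞 L) L)] [BorelSpace (AdeleRing (𝓞 L) L)]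
    [MeasurableSpace (AdeleRing (𝓞 ↥(maximalRealSubfield L)) ↥(maximalRealSubfield L))] [BorelSpace (AdeleRing (𝓞 ↥(maximalRealSubfield L)) ↥(maximalRealSubfield L))]
    [MeasurableSpace (InfiniteAdeleRing L)] [BorelSpace (InfiniteAdeleRing L)]
    [MeasurableSpace (InfiniteAdeleRing ↥(maximalRealSubfield L))] [BorelSpace (InfiniteAdeleRing ↥(maximalRealSubfield L))]
    [MeasurableSpace (FiniteAdeleRing (𝓞 L) L)] [BorelSpace (FiniteAdeleRing (𝓞 L) L)]
    [MeasurableSpace (FiniteAdeleRing (𝓞 ↥(maximalRealSubfield L)) ↥(maximalRealSubfield L))] [BorelSpace (FiniteAdeleRing (𝓞 ↥(maximalRealSubfield L)) ↥(maximalRealSubfield L))]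
    [∀ v : HeightOneSpectrum (𝓞 ↥(maximalRealSubfield L)), MeasurableSpace (v.adicCompletion ↥(maximalRealSubfield L))] [∀ v : HeightOneSpectrum (𝓞 ↥(maximalRealSubfield L)), BorelSpace (v.adicCompletion ↥(maximalRealSubfield L))]
    (ν : Measure ↥(adelicUnipotent ↥(maximalRealSubfield L) L (IsCMField.complexConj L) 3)) [ν.IsHaarMeasure]
    {𝓕 : Set ↥(adelicUnipotent ↥(maximalRealSubfield L) L (IsCMField.complexConj L) 3)} (h𝓕 : IsFundamentalDomain ↥(rationalUnipotent ↥(maximalRealSubfield L) L (IsCMField.complexConj L) 3) 𝓕 ν)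
    (μE : Measure (AdeleRing (𝓞 L) L)) [μE.IsAddHaarMeasure] (μE₁ : Measure (InfiniteAdeleRing L)) [μE₁.IsAddHaarMeasure]
    (μE₂ : Measure (FiniteAdeleRing (𝓞 L) L)) [μE₂.IsAddHaarMeasure]
    (μF : Measure (AdeleRing (𝓞 ↥(maximalRealSubfield L)) ↥(maximalRealSubfield L))) [μF.IsAddHaarMeasure] (μF₁ : Measure (InfiniteAdeleRing ↥(maximalRealSubfield L))) [μF₁.IsAddHaarMeasure]
    (μF₂ : Measure (FiniteAdeleRing (𝓞 ↥(maximalRealSubfield L)) ↥(maximalRealSubfield L))) [μF₂.IsAddHaarMeasure]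
    (νv : ∀ v : HeightOneSpectrum (𝓞 ↥(maximalRealSubfield L)), Measure (v.adicCompletion ↥(maximalRealSubfield L))) [∀ v, (νv v).IsAddHaarMeasure] :
    ∃ C : ℝ, 0 < C ∧ ∀ (S₀ : Finset (HeightOneSpectrum (𝓞 ↥(maximalRealSubfield L))))
      (hgood : ∀ v ∉ S₀, Algebra.IsUnramifiedIn (𝓞 L) v.asIdeal ∧ Valued.v (2 : v.adicCompletion ↥(maximalRealSubfield L)) = 1 ∧
        ∀ w : PlacesOver L v, Valued.v (algebraMap L (LocalRing L v) δ w) = 1) {σ : ℝ} (hσ : 2 < σ)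
      (hT : Integrable (fun v : ↥(adelicUnipotent ↥(maximalRealSubfield L) L (IsCMField.complexConj L) 3) =>
        ((((borelHeight (((quasiSplit (↥(maximalRealSubfield L)) L (IsCMField.complexConj L) 3).toAdelic (weylLongU ((IsCMField.complexConj L : L ≃ₐ[↥(maximalRealSubfield L)] L) : L →+* L) (rfl : ((StdForm.antidiagonal 3).over L) = ((StdForm.antidiagonal 3).over L)))) * (v : (quasiSplit (↥(maximalRealSubfield L)) L (IsCMField.complexConj L) 3).Adelic))) : ℝ) ^ σ : ℝ) : ℂ)) ν),
      ((ν 𝓕).toReal⁻¹ : ℝ) • ∫ v : ↥(adelicUnipotent ↥(maximalRealSubfield L) L (IsCMField.complexConj L) 3),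
          ((((borelHeight (((quasiSplit (↥(maximalRealSubfield L)) L (IsCMField.complexConj L) 3).toAdelic (weylLongU ((IsCMField.complexConj L : L ≃ₐ[↥(maximalRealSubfield L)] L) : L →+* L) (rfl : ((StdForm.antidiagonal 3).over L) = ((StdForm.antidiagonal 3).over L)))) * (v : (quasiSplit (↥(maximalRealSubfield L)) L (IsCMField.complexConj L) 3).Adelic))) : ℝ) ^ σ : ℝ) : ℂ) ∂ν =
        (C : ℂ) * (∫ Xi : InfiniteAdeleRing L, ∫ a : InfiniteAdeleRing ↥(maximalRealSubfield L), ((((∏ w : InfinitePlace L, ((1 + ‖(Xi) w‖ ^ 2 / 2) ^ 2 + (w δ) ^ 2 * (((InfiniteAdeleRing.ringEquiv_mixedSpace ↥(maximalRealSubfield L)) a).1 ⟨w.comap (algebraMap ↥(maximalRealSubfield L) L), K2E1HeightBigCellLineFormulaU2.isReal_comap_maximalRealSubfield L w⟩) ^ 2))) ^ (-σ) : ℝ) : ℂ) ∂μF₁ ∂μE₁) *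
          ((∏ v ∈ S₀, ((Measure.pi fun _ : Fin 3 => νv v) (integralBox ↥(maximalRealSubfield L) (Fin 3) v)).toReal⁻¹ •
              ∫ p : Fin 3 → v.adicCompletion ↥(maximalRealSubfield L),
                (((∏ w' : PlacesOver L v, max 1 (max ((normAbs (w'.1.adicCompletion L) (quadraticLocalEquiv L v (IsCMField.complexConj L) hcδ hδ (p 0, p 1) w') : ℝ≥0) : ℝ)
                  ((normAbs (w'.1.adicCompletion L) ((toLocalRing L v (p 2) * algebraMap L (LocalRing L v) δ -
                    toLocalRing L v 2⁻¹ * (quadraticLocalEquiv L v (IsCMField.complexConj L) hcδ hδ (p 0, p 1) *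
                      conjLocal L (IsCMField.complexConj L) v (quadraticLocalEquiv L v (IsCMField.complexConj L) hcδ hδ (p 0, p 1)))) w') : ℝ≥0) : ℝ))) ^ (-σ) : ℝ) : ℂ)
                ∂(Measure.pi fun _ : Fin 3 => νv v)) *
            ((partialStandardL (↑S₀ : Set (HeightOneSpectrum (𝓞 ↥(maximalRealSubfield L)))) (fun _ => {1}) ((σ : ℂ) - 1) * partialStandardL (↑S₀ : Set (HeightOneSpectrum (𝓞 ↥(maximalRealSubfield L)))) (fun v => {(quadraticHeckeCharCM L).valueAtUniformizer v}) ((σ : ℂ) - 1) *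
                partialStandardL (↑S₀ : Set (HeightOneSpectrum (𝓞 ↥(maximalRealSubfield L)))) (fun v => {(quadraticHeckeCharCM L).valueAtUniformizer v}) (2 * (σ : ℂ) - 2)) /
              (partialStandardL (↑S₀ : Set (HeightOneSpectrum (𝓞 ↥(maximalRealSubfield L)))) (fun _ => {1}) (σ : ℂ) * partialStandardL (↑S₀ : Set (HeightOneSpectrum (𝓞 ↥(maximalRealSubfield L)))) (fun v => {(quadraticHeckeCharCM L).valueAtUniformizer v}) (σ : ℂ) *
                partialStandardL (↑S₀ : Set (HeightOneSpectrum (𝓞 ↥(maximalRealSubfield L)))) (fun v => {(quadraticHeckeCharCM L).valueAtUniformizer v}) (2 * (σ : ℂ) - 1)))) := by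
  obtain ⟨C, hC, h⟩ := exists_pos_inv_measure_smul_integral_rpow_borelHeight_eq_eulerProduct_three L hc hcδ hδ hd ν h𝓕 μE μE₁ μE₂ μF μF₁ μF₂ νv
  exact ⟨C, hC, fun S₀ hgood σ hσ hT => h S₀ hgood hσ hT
    (integrable_prod_heightFactor_rpow_of_integrable L hc hcδ hδ hc1 hIw ν μE μE₁ μE₂ μF μF₁ μF₂ hσ hT)⟩

end Summit.HodgeConjecture.HodgeConjecture.Cruxes.H413.K2E1IntertwiningFiniteIntegrabilityU3

end
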